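import Mathlib
import Literature.NumberTheory.ComplexMultiplication.InducedCMType
import HarnessLib

/-!
# The reflex is insensitive to induction

Streng, *Complex multiplication of abelian surfaces* (2010), Ch. I (3.6) and Lemma 7.3 [Streng2010]: for a CM type `Φ` of
`K` induced from `Φ₁` on a subfield `K₁`, the groups `{σ ∣ σΦ_L = Φ_L}` attached to `Φ`, to `Φ₁` and to the induced type
`Φ_L` on the normal closure all coincide, so the reflex field (the fixed field of `{σ ∣ σΦ = Φ}`, Streng §4 / Lemma 7.3;
Shimura, *Abelian Varieties with Complex Multiplication and Modular Functions* (1998) §8.3 [Shimura1998]) and the sets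
`S`, `S*` of Shimura §8.1–8.3 do not change when a type is replaced by the type it induces.

Abstract form (the setting of `ReflexType`: a group `G` acting on `E` and on `E₀`, a `G`-equivariant "restriction" map
`r : E → E₀`, and the induced type `r ⁻¹' Φ₀` of a type `Φ₀ ⊆ E₀`):

* `typeLift_preimage`, `reflexLift_preimage` — `S` and `S*` of `(r ⁻¹' Φ₀, φh)` are those of `(Φ₀, r φh)`;
* `stabilizer_le_stabilizer_preimage`, `stabilizer_preimage_eq` — `Stab(Φ₀) ≤ Stab(r ⁻¹' Φ₀)`, with equality for `r`
  surjective; hence `reflexField_preimage_eq`.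

Concrete forms: restriction of `F`-embeddings along `k : K₀ →ₐ[F] K` (`restrictEmb`, equivariant for the composition
action of `EmbeddingAction`, surjective over a normal `Ω/F` as soon as `K` embeds at all,
`restrictEmb_surjective`), giving `reflexField_preimage_restrictEmb` ("the reflex field of the induced type is the reflex
field of the type"); and for complex CM types, `valuedIn ι (inducedCMType k Φ) = (· ∘ k) ⁻¹' valuedIn ι Φ`
(`valuedIn_inducedCMType`) with `stabilizer_valuedIn_inducedCMType_eq`.

Everything here is proved.

## Provenance

Staged by the pub-hodgecm formalisation cell (DAG-node prover #04 lineage) under the LEAN-IN-TREE rule (the "B3" step of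
the cell's reflex-field bookkeeping: the reflex field of an inflated type equals that of the type it is inflated from).
-/

set_option autoImplicit false

open scoped Pointwise

namespace Literature.NumberTheory.ComplexMultiplication

section Abstract

variable {G E E₀ : Type*} [Group G] [MulAction G E] [MulAction G E₀]

/-- `S(r⁻¹Φ₀, φh) = S(Φ₀, r φh)` for an equivariant `r`. [cite: Streng2010, Ch. I (3.6)] -/
theorem typeLift_preimage (r : E →[G] E₀) (Φ₀ : Set E₀) (φh : E) :
    (typeLift (r ⁻¹' Φ₀) φh : Set G) = typeLift Φ₀ (r φh) := by
  ext g
  rw [mem_typeLift, mem_typeLift, Set.mem_preimage, map_smul]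

/-- `S*(r⁻¹Φ₀, φh) = S*(Φ₀, r φh)` for an equivariant `r`. [cite: Streng2010, Ch. I (3.6)] -/
theorem reflexLift_preimage (r : E →[G] E₀) (Φ₀ : Set E₀) (φh : E) :
    (reflexLift (r ⁻¹' Φ₀) φh : Set G) = reflexLift Φ₀ (r φh) := by
  ext g
  rw [mem_reflexLift, mem_reflexLift, Set.mem_preimage, map_smul]

variable (G) in
/-- `Stab(Φ₀) ≤ Stab(r⁻¹Φ₀)`: an element stabilising a type stabilises every type induced from it. [folklore] -/
theorem stabilizer_le_stabilizer_preimage (r : E →[G] E₀) (Φ₀ : Set E₀) :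
    MulAction.stabilizer G Φ₀ ≤ MulAction.stabilizer G (r ⁻¹' Φ₀) := by
  intro g hg
  rw [MulAction.mem_stabilizer_iff] at hg ⊢
  ext φ
  rw [Set.mem_smul_set_iff_inv_smul_mem, Set.mem_preimage, Set.mem_preimage, map_smul,
    ← Set.mem_smul_set_iff_inv_smul_mem, hg]

variable (G) in
/-- `Stab(r⁻¹Φ₀) = Stab(Φ₀)` when the restriction map `r` is surjective (every embedding of the subfield extends):
the group cutting out the reflex field does not see induction. [cite: Streng2010, Ch. I Lemma 7.3] -/
theorem stabilizer_preimage_eq (r : E →[G] E₀) (hr : Function.Surjective r) (Φ₀ : Set E₀) :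
    MulAction.stabilizer G (r ⁻¹' Φ₀) = MulAction.stabilizer G Φ₀ := by
  refine le_antisymm ?_ (stabilizer_le_stabilizer_preimage G r Φ₀)
  intro g hg
  rw [MulAction.mem_stabilizer_iff] at hg ⊢
  ext ψ
  obtain ⟨φ, rfl⟩ := hr ψ
  rw [Set.mem_smul_set_iff_inv_smul_mem, ← map_smul, ← Set.mem_preimage (f := ⇑r) (s := Φ₀),
    ← Set.mem_smul_set_iff_inv_smul_mem, hg, Set.mem_preimage]

/-- The reflex field of an induced type equals the reflex field of the type (abstract form, `r` surjective).
[cite: Streng2010, Ch. I Lemma 7.3] -/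
theorem reflexField_preimage_eq (F Ω : Type*) [Field F] [Field Ω] [Algebra F Ω] [MulAction (Ω ≃ₐ[F] Ω) E]
    [MulAction (Ω ≃ₐ[F] Ω) E₀] (r : E →[Ω ≃ₐ[F] Ω] E₀) (hr : Function.Surjective r) (Φ₀ : Set E₀) :
    reflexField F Ω (r ⁻¹' Φ₀) = reflexField F Ω Φ₀ := by
  rw [reflexField, reflexField, stabilizer_preimage_eq (Ω ≃ₐ[F] Ω) r hr]

end Abstract

section Embeddings

variable {F K₀ K Ω : Type*} [Field F] [Field K₀] [Field K] [Field Ω] [Algebra F K₀] [Algebra F K] [Algebra F Ω]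

/-- Restriction of `F`-embeddings along `k : K₀ →ₐ[F] K`, `φ ↦ φ ∘ k`, as a `Gal(Ω/F)`-equivariant map for the
composition actions of `EmbeddingAction`. [folklore] -/
def restrictEmb (k : K₀ →ₐ[F] K) : (K →ₐ[F] Ω) →[Ω ≃ₐ[F] Ω] (K₀ →ₐ[F] Ω) where
  toFun φ := φ.comp k
  map_smul' _ _ := rfl

/-- [folklore] -/
@[simp] theorem restrictEmb_apply (k : K₀ →ₐ[F] K) (φ : K →ₐ[F] Ω) : restrictEmb (Ω := Ω) k φ = φ.comp k := rfl

/-- Over a normal `Ω/F`, once `K` embeds into `Ω` at all, every `F`-embedding of the subfield `K₀` is the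
restriction of one of `K`. [folklore] -/
theorem restrictEmb_surjective [Normal F Ω] (k : K₀ →ₐ[F] K) (φ : K →ₐ[F] Ω) :
    Function.Surjective (restrictEmb (Ω := Ω) k) := by
  intro ψ
  obtain ⟨σ, hσ⟩ := exists_algEquiv_smul_eq (φ.comp k) ψ
  exact ⟨σ • φ, by rw [map_smul, restrictEmb_apply, hσ]⟩

/-- **The reflex field of the induced type `{φ ∣ φ ∘ k ∈ Φ₀}` of `K` equals the reflex field of the type `Φ₀` of
`K₀`** (`Ω/F` normal, `K` embeddable in `Ω`). [cite: Streng2010, Ch. I Lemma 7.3] -/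
theorem reflexField_preimage_restrictEmb [Normal F Ω] (k : K₀ →ₐ[F] K) (φ : K →ₐ[F] Ω) (Φ₀ : Set (K₀ →ₐ[F] Ω)) :
    reflexField F Ω ((restrictEmb (Ω := Ω) k) ⁻¹' Φ₀) = reflexField F Ω Φ₀ :=
  reflexField_preimage_eq F Ω (restrictEmb k) (restrictEmb_surjective k φ) Φ₀

end Embeddings

section Complex

open Literature.AlgebraicGeometry.Motives (CMType)

variable {K₀ K L : Type*} [Field K₀] [Field K] [Field L]

/-- Restriction of ring embeddings along `k : K₀ →+* K`, `σ ↦ σ ∘ k`, equivariant for `Aut(L)` acting by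
composition. [folklore] -/
def restrictRingEmb (k : K₀ →+* K) : (K →+* L) →[L ≃+* L] (K₀ →+* L) where
  toFun σ := σ.comp k
  map_smul' _ _ := rfl

/-- [folklore] -/
@[simp] theorem restrictRingEmb_apply (k : K₀ →+* K) (σ : K →+* L) : restrictRingEmb (L := L) k σ = σ.comp k :=
  rfl

/-- Reading an induced complex CM type in `Hom(K, L)` is inducing the read type:
`valuedIn ι (Φ₀)_K = (· ∘ k)⁻¹ (valuedIn ι Φ₀)`. [folklore] -/
theorem valuedIn_inducedCMType (ι : L →+* ℂ) (k : K₀ →+* K) (Φ₀ : CMType K₀) :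
    valuedIn ι (inducedCMType k Φ₀).1 = (restrictRingEmb (L := L) k) ⁻¹' valuedIn ι Φ₀.1 := by
  ext σ
  simp [valuedIn, RingHom.comp_assoc]

/-- Over `L/ℚ` normal (char. 0), once `K` embeds into `L`, restriction `Hom(K, L) → Hom(K₀, L)` is onto. [folklore] -/
theorem restrictRingEmb_surjective [CharZero K₀] [CharZero L] [Normal ℚ L] (k : K₀ →+* K) (j : K →+* L) :
    Function.Surjective (restrictRingEmb (L := L) k) := by
  intro ψ
  obtain ⟨g, hg⟩ := exists_ringEquiv_smul_eq (j.comp k) ψ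
  exact ⟨g • j, by rw [map_smul, restrictRingEmb_apply, hg]⟩

/-- **The stabiliser (hence the reflex field) of a complex CM type read in `L` does not change under induction**:
`Stab_{Aut L}(valuedIn ι (Φ₀)_K) = Stab_{Aut L}(valuedIn ι Φ₀)` for `L/ℚ` normal and `K ↪ L`.
[cite: Streng2010, Ch. I Lemma 7.3] -/
theorem stabilizer_valuedIn_inducedCMType_eq [CharZero K₀] [CharZero L] [Normal ℚ L] (ι : L →+* ℂ)
    (k : K₀ →+* K) (j : K →+* L) (Φ₀ : CMType K₀) :
    MulAction.stabilizer (L ≃+* L) (valuedIn ι (inducedCMType k Φ₀).1) =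
      MulAction.stabilizer (L ≃+* L) (valuedIn ι Φ₀.1) := by
  rw [valuedIn_inducedCMType, stabilizer_preimage_eq (L ≃+* L) _ (restrictRingEmb_surjective k j)]

/-- `S` of the induced type at `j` is `S` of the type at `j ∘ k`. [cite: Streng2010, Ch. I (3.6)] -/
theorem typeLift_valuedIn_inducedCMType (ι : L →+* ℂ) (k : K₀ →+* K) (j : K →+* L) (Φ₀ : CMType K₀) :
    (typeLift (valuedIn ι (inducedCMType k Φ₀).1) j : Set (L ≃+* L)) = typeLift (valuedIn ι Φ₀.1) (j.comp k) := by
  rw [valuedIn_inducedCMType, typeLift_preimage, restrictRingEmb_apply]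

/-- `S*` of the induced type at `j` is `S*` of the type at `j ∘ k`. [cite: Streng2010, Ch. I (3.6)] -/
theorem reflexLift_valuedIn_inducedCMType (ι : L →+* ℂ) (k : K₀ →+* K) (j : K →+* L) (Φ₀ : CMType K₀) :
    (reflexLift (valuedIn ι (inducedCMType k Φ₀).1) j : Set (L ≃+* L)) =
      reflexLift (valuedIn ι Φ₀.1) (j.comp k) := by
  rw [valuedIn_inducedCMType, reflexLift_preimage, restrictRingEmb_apply]

end Complex

end Literature.NumberTheory.ComplexMultiplication
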